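import Mathlib.MeasureTheory.Function.LpSeminorm.CompareExp
import Mathlib.MeasureTheory.Function.LpSpace.Basic
import Mathlib.Analysis.SpecialFunctions.Pow.Asymptotics
import Literature.Analysis.FluidPDE.HarmonicProbe
import HarnessLib

/-!
# Liouville's theorem for harmonic functions in `L^q`

Analysis/FluidPDE support file for the decomposition of the named fact `Literature.Analysis.FluidPDE.tsai_selfsimilar`
(`FluidPDE/SelfSimilarLiouville`; Tsai, ARMA 143 (1998), Theorem 1). The last step of Tsai's
proof reads: "we get `−νΔUᵢ = 0` for each `i`. Since `U ∈ L^q(ℝ³)` in Theorem 1 …, the usual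
Liouville theorem implies that the `Uᵢ` are `0`" (Tsai 1998, pp. 48–49). This file proves that
Liouville theorem:

* `Literature.Analysis.FluidPDE.eq_zero_of_harmonic_memLp`: on a nontrivial finite-dimensional real inner product
  space `E` (with its Lebesgue measure), a harmonic `η : E → ℝ` (Mathlib
  `InnerProductSpace.HarmonicOnNhd η univ`) with `η ∈ L^q`, `1 ≤ q < ∞`, vanishes identically;
* `Literature.Analysis.FluidPDE.eq_zero_of_harmonic_memLp_inner`: the same for maps into a real inner product space;
* `Literature.Analysis.FluidPDE.harmonicOnNhd_of_laplacian_eq_zero`: `C²` with `Δf = 0` pointwise is harmonic.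

## Proof

By the mean value property against the unit-mass bumps `χ_R` of `HarmonicProbe`
(`integral_probeBump_mul_comp_sub`: `η(y) = ∫ χ_R(z) η(y − z) dz`, `|χ_R| ≤ (m R^d)⁻¹`,
`supp χ_R ⊆ B̄(0, 2R)`) and Hölder's inequality on the ball,
`|η(y)| ≤ (m R^d)⁻¹ ∫_{B̄(y,2R)} |η| ≤ (m R^d)⁻¹ ‖η‖_q |B̄(y, 2R)|^{1−1/q} = K R^{−d/q} → 0`
as `R → ∞` (`d = dim E ≥ 1`, `q < ∞`). (Nontriviality is needed: on the zero space constants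
are harmonic and in `L^q`.)

## References

* T.-P. Tsai, *On Leray's self-similar solutions of the Navier–Stokes equations satisfying
  local energy estimates*, Arch. Rational Mech. Anal. 143 (1998), pp. 48–49 (proof of Theorems
  1 and 2, last step) [Tsai1998].
* D. Gilbarg, N. S. Trudinger, *Elliptic partial differential equations of second order*,
  Thm 2.1 (mean value property) [GilbargTrudinger2001].
-/

noncomputable section

open MeasureTheory Set Filter Topology InnerProductSpace Function Metric
open scoped RealInnerProductSpace Laplacian ContDiff ENNReal

namespace Literature.Analysis.FluidPDE

variable {E : Type*} [NormedAddCommGroup E] [InnerProductSpace ℝ E] [FiniteDimensional ℝ E]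

/-- A `C²` function with identically vanishing Laplacian is harmonic on the whole space in
Mathlib's sense (`HarmonicAt f x ↔ ContDiffAt ℝ 2 f x ∧ Δf = 0` near `x`). [folklore] -/
theorem harmonicOnNhd_of_laplacian_eq_zero {F : Type*} [NormedAddCommGroup F] [NormedSpace ℝ F]
    {f : E → F} (hf : ContDiff ℝ 2 f) (hΔ : ∀ x, (Δ f) x = 0) : HarmonicOnNhd f univ :=
  fun _ _ => ⟨hf.contDiffAt, Eventually.of_forall hΔ⟩

variable [MeasurableSpace E] [BorelSpace E]

/-- **Mean-value bound over a ball**: for `η` harmonic on `E` and `R > 0`,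
`|η(y)| ≤ (m R^d)⁻¹ ∫_{B̄(y, 2R)} |η|`, where `χ_R = (m R^d)⁻¹ θ(R⁻¹·)` are the unit-mass bumps
of `HarmonicProbe` (`η(y) = ∫ χ_R(z) η(y − z) dz`, `|χ_R| ≤ (m R^d)⁻¹`, `supp χ_R ⊆ B̄(0, 2R)`;
Gilbarg–Trudinger Thm 2.1). [cite: GilbargTrudinger2001, Thm 2.1] -/
theorem abs_le_inv_mul_setIntegral_of_harmonic {η : E → ℝ} (hη : HarmonicOnNhd η univ) {R : ℝ}
    (hR : 0 < R) (y : E) :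
    |η y| ≤ (baseBumpMass E * R ^ Module.finrank ℝ E)⁻¹ * ∫ w in closedBall y (2 * R), |η w| := by
  have hηc : Continuous η := (contDiff_two_of_harmonicOnNhd_univ hη).continuous
  set c := (baseBumpMass E * R ^ Module.finrank ℝ E)⁻¹ with hc
  have hc0 : 0 ≤ c := inv_nonneg.2 (mul_nonneg baseBumpMass_pos.le (pow_nonneg hR.le _))
  rw [← integral_probeBump_mul_comp_sub hη hR y]
  -- pointwise domination by the indicator of the ball
  set g : E → ℝ := fun z => (closedBall (0 : E) (2 * R)).indicator (fun z => c * |η (y - z)|) z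
    with hg
  have hdom : ∀ z, ‖probeBump R z * η (y - z)‖ ≤ g z := by
    intro z
    simp only [hg]
    by_cases hz : z ∈ closedBall (0 : E) (2 * R)
    · rw [indicator_of_mem hz, Real.norm_eq_abs, abs_mul]
      exact mul_le_mul_of_nonneg_right (abs_probeBump_le hR z) (abs_nonneg _)
    · rw [indicator_of_notMem hz]
      rw [mem_closedBall_zero_iff, not_le] at hz
      rw [probeBump_eq_zero hR hz.le, zero_mul, norm_zero]
  have hgi : Integrable g := by
    rw [hg, integrable_indicator_iff measurableSet_closedBall]
    exact ((continuous_const.mul ((hηc.comp (continuous_const.sub continuous_id)).abs))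
      |>.continuousOn.integrableOn_compact (isCompact_closedBall _ _))
  refine (norm_integral_le_of_norm_le hgi (Eventually.of_forall hdom)).trans_eq ?_
  -- evaluate `∫ g`
  rw [hg, integral_indicator measurableSet_closedBall, integral_const_mul]
  congr 1
  -- change of variables `w = y - z`
  have h1 : ∫ z in closedBall (0 : E) (2 * R), |η (y - z)| =
      ∫ z, (closedBall (0 : E) (2 * R)).indicator (fun z => |η (y - z)|) z := by
    rw [integral_indicator measurableSet_closedBall]
  have h2 : ∫ w in closedBall y (2 * R), |η w| =
      ∫ w, (closedBall y (2 * R)).indicator (fun w => |η w|) w := by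
    rw [integral_indicator measurableSet_closedBall]
  rw [h1, h2, ← integral_sub_left_eq_self
    (fun w => (closedBall y (2 * R)).indicator (fun w => |η w|) w) volume y]
  refine integral_congr_ae (Eventually.of_forall fun z => ?_)
  change (closedBall (0 : E) (2 * R)).indicator (fun z => |η (y - z)|) z =
    (closedBall y (2 * R)).indicator (fun w => |η w|) (y - z)
  have : (z ∈ closedBall (0 : E) (2 * R)) ↔ (y - z ∈ closedBall y (2 * R)) := by
    rw [mem_closedBall_zero_iff, mem_closedBall, dist_eq_norm, sub_sub_cancel_left, norm_neg]
  by_cases hz : z ∈ closedBall (0 : E) (2 * R)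
  · rw [indicator_of_mem hz, indicator_of_mem (this.1 hz)]
  · rw [indicator_of_notMem hz, indicator_of_notMem (fun h => hz (this.2 h))]

/-- **Hölder on a set of finite measure**: `∫_B |η| ≤ ‖η‖_{L^q} · |B|^{1 − 1/q}` for `1 ≤ q`
(Mathlib's `eLpNorm_le_eLpNorm_mul_rpow_measure_univ` on the restricted measure). [folklore] -/
theorem setIntegral_abs_le_eLpNorm_mul_measure_rpow {η : E → ℝ}
    (hηm : AEStronglyMeasurable η volume) {q : ℝ≥0∞} (hq1 : 1 ≤ q)
    (hfin : eLpNorm η q volume < ⊤) {B : Set E} (hB : volume B < ⊤) :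
    ∫ w in B, |η w| ≤ (eLpNorm η q volume).toReal * (volume B).toReal ^ (1 - 1 / q.toReal) := by
  have hηm' : AEStronglyMeasurable η (volume.restrict B) := hηm.restrict
  have h1 : ∫ w in B, |η w| = (eLpNorm η 1 (volume.restrict B)).toReal := by
    rw [eLpNorm_one_eq_lintegral_enorm, ← integral_norm_eq_lintegral_enorm hηm']
    rfl
  have h2 : eLpNorm η 1 (volume.restrict B) ≤
      eLpNorm η q volume * (volume B) ^ (1 - 1 / q.toReal) := by
    have := eLpNorm_le_eLpNorm_mul_rpow_measure_univ hq1 hηm'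
    rw [Measure.restrict_apply_univ, ENNReal.toReal_one, div_one] at this
    exact this.trans (mul_le_mul_left (eLpNorm_mono_measure η Measure.restrict_le_self) _)
  have he : 0 ≤ 1 - 1 / q.toReal := by
    rw [sub_nonneg]
    rcases eq_or_ne q ⊤ with h | h
    · simp [h]
    · rw [div_le_one (ENNReal.toReal_pos (one_pos.trans_le hq1).ne' h)]
      have := ENNReal.toReal_mono h hq1
      rwa [ENNReal.toReal_one] at this
  have hfin2 : eLpNorm η q volume * (volume B) ^ (1 - 1 / q.toReal) ≠ ⊤ :=
    ENNReal.mul_ne_top hfin.ne (ENNReal.rpow_lt_top_of_nonneg he hB.ne).ne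
  rw [h1]
  have h3 := ENNReal.toReal_mono hfin2 h2
  rwa [ENNReal.toReal_mul, ← ENNReal.toReal_rpow] at h3

/-- **Liouville's theorem in `L^q`** ("the usual Liouville theorem", Tsai 1998, p. 49): a
harmonic function on a nontrivial finite-dimensional real inner product space which belongs to
`L^q`, `1 ≤ q < ∞`, vanishes identically. Proof: mean value over `B̄(y, 2R)` and Hölder give
`|η(y)| ≤ K R^{−d/q}`; let `R → ∞`. [cite: Tsai1998, p. 49 (proof of Theorems 1 and 2)] -/
theorem eq_zero_of_harmonic_memLp [Nontrivial E] {η : E → ℝ} (hη : HarmonicOnNhd η univ)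
    {q : ℝ≥0∞} (hq1 : 1 ≤ q) (hqtop : q ≠ ⊤) (hmem : MemLp η q volume) : η = 0 := by
  have hηc : Continuous η := (contDiff_two_of_harmonicOnNhd_univ hη).continuous
  set d := Module.finrank ℝ E with hd
  have hd1 : 1 ≤ d := Module.finrank_pos
  set qr := q.toReal with hqr
  have hqr1 : 1 ≤ qr := by
    have := ENNReal.toReal_mono hqtop hq1
    rwa [ENNReal.toReal_one] at this
  have hqr0 : 0 < qr := one_pos.trans_le hqr1
  set Nq := (eLpNorm η q volume).toReal with hNq
  have hNq0 : 0 ≤ Nq := ENNReal.toReal_nonneg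
  set v₁ := (volume (closedBall (0 : E) 1)).toReal with hv₁
  have hv₁0 : 0 ≤ v₁ := ENNReal.toReal_nonneg
  set e := 1 - 1 / qr with he
  have he0 : 0 ≤ e := by rw [he, sub_nonneg, div_le_one hqr0]; exact hqr1
  set m := baseBumpMass E with hm
  have hm0 : 0 < m := baseBumpMass_pos
  -- the bound `|η y| ≤ K (R^d)^{-1/qr}` for every `R > 0`
  set K := m⁻¹ * Nq * ((2 : ℝ) ^ d * v₁) ^ e with hK
  have hK0 : 0 ≤ K := by positivity
  have hbound : ∀ y, ∀ R : ℝ, 0 < R → |η y| ≤ K * ((R ^ d) ^ (-(1 / qr))) := by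
    intro y R hR
    have hRd : 0 < R ^ d := pow_pos hR d
    have h1 := abs_le_inv_mul_setIntegral_of_harmonic hη hR y
    have hB : volume (closedBall y (2 * R)) < ⊤ := (isCompact_closedBall _ _).measure_lt_top
    have h2 := setIntegral_abs_le_eLpNorm_mul_measure_rpow hηc.aestronglyMeasurable hq1
      hmem.eLpNorm_lt_top hB
    have hvol : (volume (closedBall y (2 * R))).toReal = (2 : ℝ) ^ d * v₁ * R ^ d := by
      rw [Measure.addHaar_closedBall' _ _ (by positivity : (0 : ℝ) ≤ 2 * R), ENNReal.toReal_mul,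
        ENNReal.toReal_ofReal (by positivity), hv₁, mul_pow, hd]
      ring
    rw [hvol] at h2
    refine h1.trans ((mul_le_mul_of_nonneg_left h2 (by positivity)).trans_eq ?_)
    rw [Real.mul_rpow (by positivity) hRd.le, hK, mul_inv]
    have : (R ^ d)⁻¹ * (R ^ d) ^ e = (R ^ d) ^ (-(1 / qr)) := by
      rw [← Real.rpow_neg_one, ← Real.rpow_add hRd, he]
      congr 1
      ring
    rw [← this]
    ring
  -- let `R → ∞`
  funext y
  rw [Pi.zero_apply]
  by_contra hne
  have hpos : 0 < |η y| := abs_pos.2 hne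
  have ht : Tendsto (fun t : ℝ => K * t ^ (-(1 / qr))) atTop (𝓝 (K * 0)) :=
    (tendsto_rpow_neg_atTop (by positivity)).const_mul K
  rw [mul_zero] at ht
  obtain ⟨t, ht1, ht2⟩ := ((ht.eventually (gt_mem_nhds hpos)).and (eventually_ge_atTop 1)).exists
  set R := max t 1 with hR
  have hR1 : 1 ≤ R := le_max_right _ _
  have hR0 : 0 < R := one_pos.trans_le hR1
  have htR : t ≤ R ^ d := by
    calc t ≤ R := le_max_left _ _
      _ = R ^ 1 := (pow_one R).symm
      _ ≤ R ^ d := pow_le_pow_right₀ hR1 hd1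
  have hmono : (R ^ d) ^ (-(1 / qr)) ≤ t ^ (-(1 / qr)) :=
    Real.rpow_le_rpow_of_nonpos (one_pos.trans_le ht2) htR (by rw [neg_nonpos]; positivity)
  have := hbound y R hR0
  have := mul_le_mul_of_nonneg_left hmono hK0
  linarith

/-- **Liouville in `L^q`, vector-valued**: a harmonic map `U : E → F` into a real inner product
space with `U ∈ L^q`, `1 ≤ q < ∞`, vanishes (apply the scalar theorem to `⟨v, U⟩` for every `v`;
Tsai 1998, p. 49, applied componentwise to `U = (U₁, U₂, U₃)`). [cite: Tsai1998, p. 49 (proof of Theorems 1 and 2)] -/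
theorem eq_zero_of_harmonic_memLp_inner [Nontrivial E] {F : Type*} [NormedAddCommGroup F]
    [InnerProductSpace ℝ F] {U : E → F} (hU : HarmonicOnNhd U univ) {q : ℝ≥0∞} (hq1 : 1 ≤ q)
    (hqtop : q ≠ ⊤) (hmem : MemLp U q volume) : U = 0 := by
  funext y
  rw [Pi.zero_apply]
  refine ext_inner_left ℝ fun v => ?_
  rw [inner_zero_right]
  have h := eq_zero_of_harmonic_memLp (hU.comp_CLM (innerSL ℝ v)) hq1 hqtop
    (ContinuousLinearMap.comp_memLp' (innerSL ℝ v) hmem)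
  have := congrFun h y
  simpa using this

end Literature.Analysis.FluidPDE

end
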